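import Literature.NumberTheory.Automorphic.IdeleClassGroupFirstCohomologyAll
import Mathlib.RepresentationTheory.Homological.GroupCohomology.LowDegree
import HarnessLib

/-!
# The idèle class group as a `ℤ[Gal(E/F)]`-module (`Rep ℤ Gal(E/F)`), and Axiom I of the global class
# formation in Mathlib's `groupCohomology`: `H¹(U, C_E) = 0` for EVERY subgroup `U ≤ Gal(E/F)` of EVERY
# finite Galois extension of number fields (Tate, Cassels–Fröhlich VII §9 Thm. 9.1)

Topic `NumberTheory/Automorphic` (idèles, idèle classes); namespace
`Literature.NumberTheory.Automorphic.IdeleClassGroup`.  One definition with its unfolding lemma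
(`classGalRepresentation` / `classGalRep`: the idèle class group `C_E = 𝕀_E/Eˣ`, written additively, as a
`ℤ`-linear representation of `Gal(E/F)` — the dictionary object through which the tree's finite-group
cohomology engine `Literature/Algebra/Homology` (Mathlib `groupCohomology`, `Rep k G`) meets the tree's
idelic class field theory) and theorems; NO named fact, no instance, no `sorry`.

* `classGalRepresentation F E : Representation ℤ (E ≃ₐ[F] E) (Additive (IdeleClassGroup E))`, `g ↦ classGalAct g`
  (`IdeleClassCharacterConjugate.classGalAct`), and `classGalRep F E : Rep ℤ (E ≃ₐ[F] E)`.
* `isZero_groupCohomology_one_res_of_forall_crossed` — the dictionary: if every crossed homomorphism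
  `H → C_E` for the action through `φ : H →* Gal(E/F)` (`f (g h) = φ g • f h · f g`, the convention of the
  tree's element-form files and of Mathlib's `IsMulCocycle₁`) is a coboundary, then
  `H¹(H, Res_φ (classGalRep F E)) = 0` (`groupCohomology.H1π_eq_zero_iff`, `mem_cocycles₁_iff`, `d₀₁`);
  `forall_crossed_of_isZero_groupCohomology_one` — the converse for `φ = id`.
* **`isZero_groupCohomology_one_classGalRep`** — `H¹(Gal(E/F), C_E) = 0` in Mathlib's `groupCohomology`
  for EVERY finite Galois extension of number fields, and **`isZero_groupCohomology_one_res_classGalRep`** —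
  `H¹(U, C_E) = 0` for EVERY subgroup `U ≤ Gal(E/F)`: Axiom I of the class formation `(Gal(E/F), C_E)` in
  exactly the shape of the field `IsClassModule.isZero_H1` of the engine's `Literature.Algebra.Homology.IsClassModule`
  — read off the tree's element-form theorems `exists_classGalAct_div_eq` / `exists_classGalAct_div_eq_subgroup`
  (`IdeleClassGroupFirstCohomologyAll`: cyclic layers by the first inequality and the norm index, Galois
  descent of idèle classes, inflation–restriction over solvable towers, Sylow transfer) through the dictionary.

What this is NOT: Axiom II (`H²(U, C_E)` cyclic of order `|U|` with compatible fundamental classes, i.e.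
`IsClassModule (classGalRep F E) φ`) — the next brick of the Route-A roadmap (FINDING-door-c6-g7 §7).

## References
* J. W. S. Cassels, A. Fröhlich (eds.), *Algebraic Number Theory* (1967), Ch. VII (J. Tate) §9 Thm. 9.1
  ("`H¹(G, C_L) = 0`"; proof: first inequality for cyclic layers, then "because of the Sylow subgroup
  argument it suffices to treat `p`-groups", solvable induction). [CasselsFrohlichANT1967]
* J. Neukirch, *Class Field Theory — The Bonn Lectures* (2013), Part III §3 (the class field axiom).
  [Neukirch2013]
* J.-P. Serre, *Local Fields*, GTM 67 (1979), Ch. VII §3 (1-cocycles and coboundaries). [SerreLocalFields1979]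
-/

noncomputable section

open CategoryTheory CategoryTheory.Limits groupCohomology

namespace Literature.NumberTheory.Automorphic

namespace IdeleClassGroup

open Literature.NumberTheory.GaloisRepresentations
open Literature.Algebra.Homology

/-! ## §1. `C_E` as a `Rep ℤ Gal(E/F)` -/

section Rep

variable (F E : Type) [Field F] [Field E] [Algebra F E] [NumberField E]

/-- **The idèle class group `C_E` (written additively) as a `ℤ`-linear representation of `Gal(E/F)`**,
`g ↦ (c ↦ g • c)` (`classGalAct`).  "The action of `G` on `C_L` is that induced by its action on `J_L`."
(The `ℤ`-module structure is the one of the additive GROUP `Additive C_E`, stated explicitly: the generic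
`Additive.addCommMonoid` of the quotient monoid is not reducibly the group's.)
[cite: CasselsFrohlichANT1967, Ch. VII §8 (before Prop. 8.1)] -/
def classGalRepresentation : @Representation ℤ (E ≃ₐ[F] E) (Additive (IdeleClassGroup E)) _ _
    AddCommGroup.toAddCommMonoid (AddCommGroup.toIntModule _) where
  toFun g := (MonoidHom.toAdditive
    (classGalAct g : IdeleClassGroup E →ₜ* IdeleClassGroup E).toMonoidHom).toIntLinearMap
  map_one' := by
    refine LinearMap.ext fun x => ?_
    change Additive.ofMul ((classGalAct (1 : E ≃ₐ[F] E)).toMonoidHom (Additive.toMul x)) = x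
    rw [classGalAct_toMonoidHom_one]
    rfl
  map_mul' g h := by
    refine LinearMap.ext fun x => ?_
    change Additive.ofMul ((classGalAct (g * h)).toMonoidHom (Additive.toMul x)) =
      Additive.ofMul ((classGalAct g).toMonoidHom (Additive.toMul
        (Additive.ofMul ((classGalAct h).toMonoidHom (Additive.toMul x)))))
    rw [classGalAct_toMonoidHom_mul]
    rfl

/-- Unfolding `classGalRepresentation`: `g • (ofMul c) = ofMul (g • c)`.
[cite: CasselsFrohlichANT1967, Ch. VII §8 (before Prop. 8.1)] -/
@[simp] theorem classGalRepresentation_apply (g : E ≃ₐ[F] E) (x : Additive (IdeleClassGroup E)) :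
    classGalRepresentation F E g x = Additive.ofMul (classGalAct g (Additive.toMul x)) := rfl

/-- **`C_E` as an object of Mathlib's `Rep ℤ Gal(E/F)`** — the `G`-module of the global class
formation `(Gal(E/F), C_E)`. [cite: CasselsFrohlichANT1967, Ch. VII §8 and §9 Thm. 9.1] -/
abbrev classGalRep : Rep ℤ (E ≃ₐ[F] E) := Rep.of (classGalRepresentation F E)

/-- Unfolding the action of `classGalRep`. [cite: CasselsFrohlichANT1967, Ch. VII §8] -/
theorem classGalRep_ρ_apply (g : E ≃ₐ[F] E) (x : Additive (IdeleClassGroup E)) :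
    (classGalRep F E).ρ g x = Additive.ofMul (classGalAct g (Additive.toMul x)) := rfl

end Rep

/-! ## §2. The dictionary: crossed homomorphisms in element form and Mathlib's `H¹` -/

section Dictionary

variable {F E : Type} [Field F] [Field E] [Algebra F E] [NumberField E]

/-- **Element form ⟹ Mathlib form.**  For a homomorphism `φ : H →* Gal(E/F)` of a group `H`: if every
crossed homomorphism `f : H → C_E` for the action through `φ` (`f (g h) = φ g • f h · f g`) is a coboundary
`g ↦ φ g • c / c`, then `H¹(H, Res_φ C_E) = 0` in Mathlib's `groupCohomology` (a `1`-cocycle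
`x : Z¹(H, Res_φ C_E)` is such an `f` read additively, and `f = ∂c` says `x = d₀₁ c`).
[cite: CasselsFrohlichANT1967, Ch. VII §9 Thm. 9.1] [cite: SerreLocalFields1979, Ch. VII §3 (1-cocycles)] -/
theorem isZero_groupCohomology_one_res_of_forall_crossed {H : Type} [Group H] (φ : H →* (E ≃ₐ[F] E))
    (helem : ∀ f : H → IdeleClassGroup E, (∀ g h, f (g * h) = classGalAct (φ g) (f h) * f g) →
      ∃ c : IdeleClassGroup E, ∀ g, classGalAct (φ g) c / c = f g) :
    IsZero (groupCohomology (Rep.res φ (classGalRep F E)) 1) := by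
  refine @ModuleCat.isZero_of_subsingleton _ _ _ ⟨fun a b => ?_⟩
  have key : ∀ z : groupCohomology (Rep.res φ (classGalRep F E)) 1, z = 0 := fun z => by
    induction z using H1_induction_on with
    | h x =>
    rw [H1π_eq_zero_iff]
    -- the crossed homomorphism of `x`
    have hx := (mem_cocycles₁_iff (A := Rep.res φ (classGalRep F E)) x).1 x.2
    obtain ⟨c, hc⟩ := helem (fun g => Additive.toMul (x g)) fun g h => by
      have h1 := hx g h
      change x (g * h) = Additive.ofMul (classGalAct (φ g) (Additive.toMul (x h))) + x g at h1
      apply Additive.ofMul.injective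
      change x (g * h) = Additive.ofMul (classGalAct (φ g) (Additive.toMul (x h))) + x g
      exact h1
    refine ⟨Additive.ofMul c, funext fun g => ?_⟩
    rw [d₀₁_hom_apply]
    change Additive.ofMul (classGalAct (φ g) c) - Additive.ofMul c = x g
    rw [← ofMul_div, hc]
    rfl
  rw [key a, key b]

/-- **Mathlib form ⟹ element form** (for the full group): if `H¹(Gal(E/F), C_E) = 0` in Mathlib's
`groupCohomology`, every crossed homomorphism `Gal(E/F) → C_E` is a coboundary.
[cite: CasselsFrohlichANT1967, Ch. VII §9 Thm. 9.1] [cite: SerreLocalFields1979, Ch. VII §3 (1-cocycles)] -/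
theorem forall_crossed_of_isZero_groupCohomology_one
    (h0 : IsZero (groupCohomology (classGalRep F E) 1))
    (f : (E ≃ₐ[F] E) → IdeleClassGroup E) (hf : ∀ g h, f (g * h) = classGalAct g (f h) * f g) :
    ∃ c : IdeleClassGroup E, ∀ g, classGalAct g c / c = f g := by
  haveI := ModuleCat.subsingleton_of_isZero h0
  -- `f` read additively is a `1`-cocycle
  have hmem : (fun g => Additive.ofMul (f g)) ∈ cocycles₁ (classGalRep F E) := by
    rw [mem_cocycles₁_iff]
    intro g h
    change Additive.ofMul (f (g * h)) = Additive.ofMul (classGalAct g (Additive.toMul (Additive.ofMul (f h)))) +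
      Additive.ofMul (f g)
    rw [hf g h]
    rfl
  have hz : H1π (classGalRep F E) ⟨_, hmem⟩ = 0 := Subsingleton.elim _ _
  rw [H1π_eq_zero_iff] at hz
  obtain ⟨m, hm⟩ := hz
  refine ⟨Additive.toMul m, fun g => ?_⟩
  have h1 := congr_fun hm g
  rw [d₀₁_hom_apply] at h1
  change Additive.ofMul (classGalAct g (Additive.toMul m)) - m = Additive.ofMul (f g) at h1
  apply Additive.ofMul.injective
  rw [ofMul_div, ← h1]
  rfl

end Dictionary

/-! ## §3. Subgroups: `H¹(P, C_E)` through the fixed field `E^P` -/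

section Subgroup

variable {F E : Type} [Field F] [Field E] [Algebra F E] [NumberField E]

omit [NumberField E] in
/-- The isomorphism `P ≃* Gal(E/E^P)` (`IntermediateField.subgroupEquivAlgEquiv`) does not change the
underlying automorphism: restricted back to `F`, `e g` is `g`. [cite: CasselsFrohlichANT1967, Ch. VII §1.1] -/
theorem restrictScalars_subgroupEquivAlgEquiv [FiniteDimensional F E] (P : Subgroup (E ≃ₐ[F] E)) (g : P) :
    (IntermediateField.subgroupEquivAlgEquiv P g).restrictScalars F = (g : E ≃ₐ[F] E) :=
  AlgEquiv.ext fun _ => rfl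

/-- **`H¹(P, C_E) = 0` in `groupCohomology` for a subgroup `P ≤ Gal(E/F)`, from the element form over the
fixed field `E^P`**: if every crossed homomorphism `Gal(E/E^P) → C_E` is a coboundary, then
`H¹(P, Res (classGalRep F E)) = 0` (`P ≃* Gal(E/E^P)`; the action of `τ ∈ Gal(E/E^P)` on `C_E` is that of
`τ|_F`, `classGalAct_restrictScalars`). [cite: CasselsFrohlichANT1967, Ch. VII §9 Thm. 9.1] -/
theorem isZero_groupCohomology_one_res_of_forall_crossed_fixedField [FiniteDimensional F E]
    (P : Subgroup (E ≃ₐ[F] E))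
    (helem : ∀ f : (E ≃ₐ[IntermediateField.fixedField P] E) → IdeleClassGroup E,
      (∀ g h, f (g * h) = classGalAct g (f h) * f g) →
        ∃ c : IdeleClassGroup E, ∀ g, classGalAct g c / c = f g) :
    IsZero (groupCohomology (Rep.res P.subtype (classGalRep F E)) 1) := by
  set e := IntermediateField.subgroupEquivAlgEquiv P with he
  have hact : ∀ (g : P) (c : IdeleClassGroup E), classGalAct (e g) c = classGalAct (g : E ≃ₐ[F] E) c :=
    fun g c => by rw [← classGalAct_restrictScalars (F := F) (e g) c, restrictScalars_subgroupEquivAlgEquiv]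
  refine isZero_groupCohomology_one_res_of_forall_crossed P.subtype fun f hf => ?_
  -- transport `f` to a crossed homomorphism of `Gal(E/E^P)`
  obtain ⟨c, hc⟩ := helem (fun τ => f (e.symm τ)) fun τ₁ τ₂ => by
    have h1 := hf (e.symm τ₁) (e.symm τ₂)
    rw [← map_mul] at h1
    rw [h1, Subgroup.coe_subtype, ← hact, MulEquiv.apply_symm_apply]
  refine ⟨c, fun g => ?_⟩
  rw [Subgroup.coe_subtype, ← hact, hc (e g), MulEquiv.symm_apply_apply]

end Subgroup

/-! ## §4. Axiom I: `H¹(Gal(E/F), C_E) = 0` and `H¹(U, C_E) = 0` for every subgroup, in `groupCohomology` -/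

section AxiomOne

variable (F E : Type) [Field F] [Field E] [Algebra F E] [NumberField F] [NumberField E]

/-- **`H¹(Gal(E/F), C_E) = 0` for EVERY finite Galois extension of number fields** (Tate, Cassels–Fröhlich
VII §9 Thm. 9.1), in Mathlib's `groupCohomology` for the `Rep` `classGalRep F E`: the tree's element-form
theorem `exists_classGalAct_div_eq` (`IdeleClassGroupFirstCohomologyAll`) through the dictionary
`isZero_groupCohomology_one_res_of_forall_crossed` (`Res_{id} = id`). [cite: CasselsFrohlichANT1967, Ch. VII §9 Thm. 9.1] -/
theorem isZero_groupCohomology_one_classGalRep [IsGalois F E] :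
    IsZero (groupCohomology (classGalRep F E) 1) :=
  isZero_groupCohomology_one_res_of_forall_crossed (F := F) (E := E) (MonoidHom.id (E ≃ₐ[F] E))
    fun f hf => exists_classGalAct_div_eq f hf

/-- **Axiom I of the global class formation: `H¹(U, C_E) = 0` for EVERY subgroup `U ≤ Gal(E/F)`** (the layer
`E/E^U`), in exactly the shape `∀ U, IsZero (groupCohomology (Rep.res U.subtype A) 1)` of the field
`IsClassModule.isZero_H1` of the engine's class modules (`Literature.Algebra.Homology.IsClassModule`):
`exists_classGalAct_div_eq` for the Galois layer `E/E^U`, transported along `U ≃* Gal(E/E^U)`.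
[cite: CasselsFrohlichANT1967, Ch. VII §9 Thm. 9.1] [cite: Neukirch2013, Part III §3 (class field axiom)] -/
theorem isZero_groupCohomology_one_res_classGalRep [IsGalois F E] (U : Subgroup (E ≃ₐ[F] E)) :
    IsZero (groupCohomology (Rep.res U.subtype (classGalRep F E)) 1) := by
  haveI : FiniteDimensional F E := Module.Finite.of_restrictScalars_finite ℚ F E
  haveI : IsGalois (IntermediateField.fixedField U) E := IsGalois.tower_top_of_isGalois F (IntermediateField.fixedField U) E
  exact isZero_groupCohomology_one_res_of_forall_crossed_fixedField U fun f hf => exists_classGalAct_div_eq f hf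

end AxiomOne

end IdeleClassGroup

end Literature.NumberTheory.Automorphic

end
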